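import Literature.Geometry.Lorentzian.CarterLayerTurningPointTortoise
import Literature.Geometry.Lorentzian.CarterLayerBarrierConstants
import Literature.Geometry.Lorentzian.CarterLayerRate
import Literature.Geometry.Lorentzian.CarterThresholdBarrierGeometry
import Literature.Geometry.Lorentzian.CarterSliverNearBarrier
import Literature.Geometry.Lorentzian.CarterFluxKernelBound
import HarnessLib

/-!
# Radial data of the Breitenlohner–Freedman barrier of Carter's equation in the threshold sliver
(namespace `Literature.Geometry.Lorentzian.Kerr`.)

The sliver companion of `CarterThresholdBarrierGeometry.threshold_barrier_radii`: Carter's radial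
equation `u″ + φu = 0`, `φ = ω² − V∘ρ` (DRSR arXiv:1402.7034 §5.2.3) at an admissible `(ω, m, Λ)` with
`σ := ω − mω₊ ≠ 0` SMALL, in a Breitenlohner–Freedman stable sector with margin
`(1 + θ₁)(2r₊ω)² ≤ Λ′` (`0 < θ₁ ≤ 1`), near extremality `r₊ − r₋ ≤ θ₁M/4`, and the census. Off the
threshold the profile bounds carry the fuzz `E* = S²/ζ² + 2|S||ω|(1 + (r₊ + r₋)/ζ)` on `r ≥ r₊ + ζ`,
`ζ = θ₁M/8`, `S = (r₊² + a²)σ` (`CarterLayerRate`); with `f = 1 + 25E*/θ₁`, `Λ′ ≥ 3.5·10¹⁰f²/θ₁³`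
and `E* ≤ θ₁Λ′/192`:

* `layer_barrier_radii` — census (`forbidden_interval`: `{φ ≤ 0} = [b₁, b₂]`, `φ b₂ = 0`, `ρ b₂ < R`),
  `ρ b₁ ≤ r₊ + X*`, `(1 + θ₁/2)r₊ ≤ ρ b₂`, the profile zero `r_t` with `|ρ b₂ − r_t| ≤ (ρ b₂ − r₊)/4`,
  `Λ′ ≤ 4ω²(ρ b₂)² ≤ 32Λ′`, the two largeness facts, and the fuzzed profile bounds themselves.

Assembly of landed facts; continued in `CarterLayerBarrierGeometry` (points, floors, layer).
Near-extremal Kerr programme, crux `KappaExplicitWaveDecay` (BF-stable large-`Λ` kernel bound).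

## References
* M. Dafermos, I. Rodnianski, Y. Shlapentokh-Rothman, arXiv:1402.7034 = Ann. of Math. 183 (2016),
  §§2.1.2, 5.2.3, 6.2–6.5, 8.7 (key `DafermosRodnianskiShlapentokhrothman2014`). Assembly folklore.
-/

noncomputable section

open Set Filter

namespace Literature.Geometry.Lorentzian

namespace Kerr

section LayerRadii

variable {M a ω Λ : ℝ} {m : ℤ} {ρ : ℝ → ℝ}

/-! ### Radial data of the sliver barrier -/

set_option maxHeartbeats 400000 in
-- census + margin + profile zero + largeness: one long assembly
/-- **Radial data of the sliver barrier.** See the module docstring; hypotheses: tortoise radius,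
sub-extremality, admissibility with `1 ≤ Λ`, `σ ≠ 0`, `ω ≠ 0`, margin `θ₁ ∈ (0, 1]`, near extremality
`r₊ − r₋ ≤ θ₁M/4`, the fuzz `E*` and `f = 1 + 25E*/θ₁` as equations, `3.5·10¹⁰f²/θ₁³ ≤ Λ′`,
`E* ≤ θ₁Λ′/192`, the cap-edge conditions of `sliver_cap_edge`, and the census. [folklore] -/
theorem layer_barrier_radii (hρ : IsTortoiseRadius M a ρ) (hMa : IsSubextremal M a)
    (hadm : IsAdmissibleTriple a ω m Λ) (hΛ1 : 1 ≤ Λ) (hσ : ω - m * horizonAngularVelocity M a ≠ 0)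
    (hω : ω ≠ 0) {θ₁ : ℝ} (hθ₁ : 0 < θ₁) (hθ₁1 : θ₁ ≤ 1)
    (hBF : (1 + θ₁) * (2 * rPlus M a * ω) ^ 2 ≤ Λ - 2 * a * m * ω)
    (hd : rPlus M a - rMinus M a ≤ θ₁ * M / 4) {Es f Xs Xl : ℝ}
    (hEs : Es = ((rPlus M a ^ 2 + a ^ 2) * (ω - m * horizonAngularVelocity M a)) ^ 2 / (θ₁ * M / 8) ^ 2 +
      2 * |(rPlus M a ^ 2 + a ^ 2) * (ω - m * horizonAngularVelocity M a)| * |ω| *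
        (1 + (rPlus M a + rMinus M a) / (θ₁ * M / 8)))
    (hf : f = 1 + 25 * Es / θ₁) (hΛ' : 3.5e10 * f ^ 2 / θ₁ ^ 3 ≤ Λ - 2 * a * m * ω)
    (hEΛ : Es ≤ θ₁ * (Λ - 2 * a * m * ω) / 192)
    (hXs : Xs = 24 * ((rPlus M a ^ 2 + a ^ 2) * (ω - m * horizonAngularVelocity M a)) ^ 2 /
      ((rPlus M a - rMinus M a) * θ₁ ^ 2 * (Λ - 2 * a * m * ω)))
    (hXl : Xl = ((rPlus M a ^ 2 + a ^ 2) * (ω - m * horizonAngularVelocity M a)) ^ 2 /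
      (8 * (rPlus M a - rMinus M a) * (|Λ - 2 * a * m * ω| + 3)))
    (hXsd : Xs ≤ rPlus M a - rMinus M a) (hXsθ : Xs ≤ θ₁ * rPlus M a / 8)
    (hK : 6 * rPlus M a * |ω| * Xl ≤ (rPlus M a ^ 2 + a ^ 2) * |ω - m * horizonAngularVelocity M a|)
    (hord : (Ioi (rPlus M a) ∩ {r : ℝ | ω ^ 2 ≤ sepPotential M a ω m Λ r}).OrdConnected) :
    ∃ b₁ b₂ rt : ℝ,
      {s | ω ^ 2 - sepPotential M a ω m Λ (ρ s) ≤ 0} = Icc b₁ b₂ ∧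
      ω ^ 2 - sepPotential M a ω m Λ (ρ b₂) = 0 ∧
      ρ b₂ < max (7 * M) (max (Real.sqrt (12 * Λ) / |ω|) (1 / (M * ω ^ 2))) ∧
      ρ b₁ - rPlus M a ≤ Xs ∧
      (1 + θ₁ / 2) * rPlus M a ≤ ρ b₂ ∧
      rPlus M a < rt ∧ rPlus M a - rMinus M a ≤ rt - rPlus M a ∧
      Λ - 2 * a * m * ω - ω ^ 2 * (rt + rPlus M a) ^ 2 * ((rt - rPlus M a) / (rt - rMinus M a)) = 0 ∧
      ρ b₂ - rt ≤ (ρ b₂ - rPlus M a) / 4 ∧ rt - ρ b₂ ≤ (ρ b₂ - rPlus M a) / 4 ∧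
      Λ - 2 * a * m * ω ≤ 4 * ω ^ 2 * ρ b₂ ^ 2 ∧ ω ^ 2 * ρ b₂ ^ 2 ≤ 8 * (Λ - 2 * a * m * ω) ∧
      368640 * f * ρ b₂ ≤ ω ^ 2 * (ρ b₂ - rPlus M a) ^ 3 ∧
      2.72e18 * f ^ 3 ≤ ω ^ 4 * (ρ b₂ - rPlus M a) ^ 3 * ρ b₂ ∧
      0 ≤ Es ∧ 1 ≤ f ∧
      (∀ r, rPlus M a + θ₁ * M / 8 ≤ r →
        delta M a r * (Λ - 2 * a * m * ω -
            ω ^ 2 * (r + rPlus M a) ^ 2 * ((r - rPlus M a) / (r - rMinus M a)) - Es) ≤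
          (r ^ 2 + a ^ 2) ^ 2 * (sepPotential M a ω m Λ r - ω ^ 2) ∧
        (r ^ 2 + a ^ 2) ^ 2 * (sepPotential M a ω m Λ r - ω ^ 2) ≤
          delta M a r * (Λ - 2 * a * m * ω -
            ω ^ 2 * (r + rPlus M a) ^ 2 * ((r - rPlus M a) / (r - rMinus M a)) + 3 + Es)) := by
  have ha : |a| < M := hMa
  have hM : 0 < M := hMa.pos
  have hrp : 0 < rPlus M a := rPlus_pos hM a
  have hMr : M ≤ rPlus M a := M_le_rPlus M a
  have hd0 : 0 < rPlus M a - rMinus M a := sub_pos.2 hMa.rMinus_lt_rPlus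
  have hrm0 : 0 ≤ rMinus M a := rMinus_nonneg_of_abs_le ha.le
  have hω0 : 0 < |ω| := abs_pos.2 hω
  have hω2 : 0 < ω ^ 2 := by positivity
  have hζ : 0 < θ₁ * M / 8 := by positivity
  have hθM : θ₁ * M ≤ θ₁ * rPlus M a := mul_le_mul_of_nonneg_left hMr hθ₁.le
  have hθM1 : θ₁ * M ≤ 1 * M := mul_le_mul_of_nonneg_right hθ₁1 hM.le
  have hθr0 : 0 < θ₁ / 2 * rPlus M a := by positivity
  set Λ' := Λ - 2 * a * m * ω with hΛ'def
  -- strict BF stability from the margin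
  have hBF4 : 4 * rPlus M a ^ 2 * ω ^ 2 < Λ' := by
    have h1 : 0 < θ₁ * (4 * rPlus M a ^ 2 * ω ^ 2) := by positivity
    have e : (1 + θ₁) * (2 * rPlus M a * ω) ^ 2 = 4 * rPlus M a ^ 2 * ω ^ 2 +
      θ₁ * (4 * rPlus M a ^ 2 * ω ^ 2) := by ring
    linarith only [hBF, h1, e]
  have hΛ'pos : 0 < Λ' := lt_of_le_of_lt (by positivity) hBF4
  have hEs0 : 0 ≤ Es := by rw [hEs]; positivity
  have hf1 : 1 ≤ f := by
    have : 0 ≤ 25 * Es / θ₁ := by positivity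
    linarith only [hf, this]
  have hθΛ' : θ₁ * Λ' ≤ Λ' := mul_le_of_le_one_left hΛ'pos.le hθ₁1
  have hE2 : Es ≤ Λ' / 2 := by linarith only [hEΛ, hθΛ', hΛ'pos]
  have hθΛ : 576 ≤ θ₁ * Λ' := by
    have hθ3 : 0 < θ₁ ^ 3 := pow_pos hθ₁ 3
    have h1 : 3.5e10 * f ^ 2 ≤ Λ' * θ₁ ^ 3 := by rwa [div_le_iff₀ hθ3] at hΛ'
    have h2 : θ₁ ^ 3 ≤ θ₁ := by
      have : θ₁ ^ 2 ≤ 1 := pow_le_one₀ hθ₁.le hθ₁1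
      nlinarith only [this, hθ₁]
    have h3 : Λ' * θ₁ ^ 3 ≤ Λ' * θ₁ := mul_le_mul_of_nonneg_left h2 hΛ'pos.le
    have h4 : (1:ℝ) ≤ f ^ 2 := one_le_pow₀ hf1
    nlinarith only [h1, h3, h4]
  have hE3 : 3 + Es ≤ Λ' := by linarith only [hE2, hθΛ, hθΛ']
  -- the fuzzed profile bounds on `r ≥ r₊ + ζ`
  have hprof : ∀ r, rPlus M a + θ₁ * M / 8 ≤ r →
      delta M a r * (Λ' - ω ^ 2 * (r + rPlus M a) ^ 2 * ((r - rPlus M a) / (r - rMinus M a)) - Es) ≤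
        (r ^ 2 + a ^ 2) ^ 2 * (sepPotential M a ω m Λ r - ω ^ 2) ∧
      (r ^ 2 + a ^ 2) ^ 2 * (sepPotential M a ω m Λ r - ω ^ 2) ≤
        delta M a r * (Λ' - ω ^ 2 * (r + rPlus M a) ^ 2 * ((r - rPlus M a) / (r - rMinus M a)) + 3 + Es) := by
    intro r hr
    have h := sq_mul_negCoeff_mem_Icc_of_layer (ω := ω) (Λ := Λ) (m := m) ha hζ hr
    rw [← hEs] at h
    exact h
  -- the margin point `r_m = (1 + θ₁/2) r₊` is in the barrier
  have hmargin : (1 + θ₁ / 2) * rPlus M a ≤ Real.sqrt Λ' / |ω| - rPlus M a :=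
    rPlus_mul_le_of_margin hω hθ₁.le (by linarith only [hθ₁1]) hBF
  have erm : (1 + θ₁ / 2) * rPlus M a = rPlus M a + θ₁ / 2 * rPlus M a := by ring
  have hrm_ζ : rPlus M a + θ₁ * M / 8 ≤ (1 + θ₁ / 2) * rPlus M a := by linarith only [erm, hθM, hζ]
  have hJm : Es ≤ Λ' - ω ^ 2 * ((1 + θ₁ / 2) * rPlus M a + rPlus M a) ^ 2 := by
    have h1 : 4 * rPlus M a ^ 2 * ω ^ 2 * (1 + θ₁) ≤ Λ' := by linarith only [hBF]
    have h2 : ω ^ 2 * ((1 + θ₁ / 2) * rPlus M a + rPlus M a) ^ 2 =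
        (2 + θ₁ / 2) ^ 2 / 4 * (4 * rPlus M a ^ 2 * ω ^ 2) := by ring
    have h3 : (2 + θ₁ / 2) ^ 2 / 4 * (4 * rPlus M a ^ 2 * ω ^ 2) * (1 + θ₁) ≤
        (2 + θ₁ / 2) ^ 2 / 4 * Λ' := by
      have := mul_le_mul_of_nonneg_left h1 (show 0 ≤ (2 + θ₁ / 2) ^ 2 / 4 by positivity)
      linarith only [this]
    have h4 : (2 + θ₁ / 2) ^ 2 / 4 ≤ (1 + θ₁) * (1 - 7 * θ₁ / 32) := by
      have t : 0 ≤ θ₁ * (1 - θ₁) := mul_nonneg hθ₁.le (by linarith only [hθ₁1])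
      linarith only [t]
    have h5 : (2 + θ₁ / 2) ^ 2 / 4 * Λ' ≤ (1 + θ₁) * (1 - 7 * θ₁ / 32) * Λ' :=
      mul_le_mul_of_nonneg_right h4 hΛ'pos.le
    have h6 : ω ^ 2 * ((1 + θ₁ / 2) * rPlus M a + rPlus M a) ^ 2 * (1 + θ₁) ≤
        (1 - 7 * θ₁ / 32) * Λ' * (1 + θ₁) := by rw [h2]; linarith only [h3, h5]
    have h7 : ω ^ 2 * ((1 + θ₁ / 2) * rPlus M a + rPlus M a) ^ 2 ≤ (1 - 7 * θ₁ / 32) * Λ' :=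
      le_of_mul_le_mul_right h6 (by linarith only [hθ₁])
    have h8 : 0 ≤ θ₁ * Λ' := by positivity
    linarith only [hEΛ, h7, h8]
  obtain ⟨tm, htm⟩ := hρ.exists_apply_eq (r := (1 + θ₁ / 2) * rPlus M a) (by linarith only [erm, hθr0])
  have hφtm : ω ^ 2 - sepPotential M a ω m Λ (ρ tm) ≤ 0 := by
    have hr : rPlus M a + θ₁ * M / 8 ≤ ρ tm := by rw [htm]; exact hrm_ζ
    have hlow := (hprof _ hr).1
    have hJ := thresholdProfile_ge (ω := ω) (Λ := Λ) (m := m) ha (hρ.rPlus_lt tm)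
    rw [htm] at hlow hJ
    rw [htm]
    have hΔ : 0 ≤ delta M a ((1 + θ₁ / 2) * rPlus M a) :=
      delta_nonneg ha.le (by linarith only [erm, hθr0])
    have hpos : 0 ≤ delta M a ((1 + θ₁ / 2) * rPlus M a) *
        (Λ' - ω ^ 2 * ((1 + θ₁ / 2) * rPlus M a + rPlus M a) ^ 2 *
          (((1 + θ₁ / 2) * rPlus M a - rPlus M a) / ((1 + θ₁ / 2) * rPlus M a - rMinus M a)) - Es) :=
      mul_nonneg hΔ (by linarith only [hJ, hJm])
    have hA : 0 < (((1 + θ₁ / 2) * rPlus M a) ^ 2 + a ^ 2) ^ 2 := by positivity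
    have h0 : 0 ≤ (((1 + θ₁ / 2) * rPlus M a) ^ 2 + a ^ 2) ^ 2 *
        (sepPotential M a ω m Λ ((1 + θ₁ / 2) * rPlus M a) - ω ^ 2) := hpos.trans hlow
    have : 0 ≤ sepPotential M a ω m Λ ((1 + θ₁ / 2) * rPlus M a) - ω ^ 2 :=
      (mul_nonneg_iff_of_pos_left hA).1 h0
    linarith only [this]
  -- the census
  obtain ⟨xa, hxa⟩ := hρ.exists_apply_eq
    (r := rPlus M a + (ω - m * horizonAngularVelocity M a) ^ 2 * M ^ 3 / (416 * Λ))
    (by have : 0 < (ω - m * horizonAngularVelocity M a) ^ 2 * M ^ 3 / (416 * Λ) := by positivity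
        linarith only [this])
  rcases forbidden_interval hρ hMa hadm hΛ1 hσ hω hord hxa with hall | ⟨b₁, b₂, -, -, -, hb₂R, hF, -, hφb₂⟩
  · exact absurd (hall tm) (not_lt.2 hφtm)
  have hmem : ∀ x, ω ^ 2 - sepPotential M a ω m Λ (ρ x) ≤ 0 ↔ x ∈ Icc b₁ b₂ := fun x ↦ by
    rw [← hF]; rfl
  have htm_mem : tm ∈ Icc b₁ b₂ := (hmem tm).1 hφtm
  have hrb_lo : (1 + θ₁ / 2) * rPlus M a ≤ ρ b₂ := by
    rw [← htm]; exact (hρ.strictMono hMa).monotone htm_mem.2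
  obtain ⟨-, hb1u, -⟩ := sliver_cap_edge hρ hMa hθ₁ hθ₁1 hBF hΛ'pos hF hXs hXl hXsd hXsθ hK
  set rb := ρ b₂ with hrbdef
  set δ := rb - rPlus M a with hδdef
  have hδlo : θ₁ * rPlus M a / 2 ≤ δ := by rw [hδdef]; linarith only [hrb_lo, erm]
  have hδ : 0 < δ := lt_of_lt_of_le (by positivity) hδlo
  have hrb0 : 0 < rb := by linarith only [hδ, hδdef, hrp]
  have hrbζ : rPlus M a + θ₁ * M / 8 ≤ rb := by linarith only [hrm_ζ, hrb_lo]
  have hrbd : rPlus M a - rMinus M a ≤ rb - rPlus M a := by linarith only [hd, hθM, hδlo, hδdef, hδ, hζ]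
  -- the profile zero
  have hd2 : rPlus M a - rMinus M a ≤ rPlus M a / 2 := by linarith only [hd, hθM1, hMr, hM]
  obtain ⟨rt, hrt, hrt1, hrt2, hJrt, -, -⟩ :=
    exists_thresholdProfile_zero (Λ := Λ) (m := m) ha hω hd2 hBF4
  have hrt_lo : (1 + θ₁ / 2) * rPlus M a ≤ rt := by linarith only [hmargin, hrt1]
  have hrtd : rPlus M a - rMinus M a ≤ rt - rPlus M a := by linarith only [hrt_lo, erm, hθM, hd, hζ]
  have hrtp0 : 0 < rt + rPlus M a := by linarith only [hrt, hrp]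
  have hV : sepPotential M a ω m Λ (ρ b₂) = ω ^ 2 := by linarith only [hφb₂]
  obtain ⟨hlowb, hupb⟩ := hprof rb hrbζ
  obtain ⟨hJb3, hJbE, h3, h4⟩ :=
    layer_turningRadius (Λ := Λ) ha hω hEs0 hrt hrtd hJrt (hρ.rPlus_lt b₂) hrbd hV hlowb hupb
  -- `Λ′ ≤ ω²(r_t + r₊)² ≤ 2Λ′` and `Λ′ − E ≤ ω²(r_b + r₊)²`, `ω²(r_b + r₊)²/2 ≤ Λ′ + 3 + E`
  have hsq : Λ' ≤ ω ^ 2 * (rt + rPlus M a) ^ 2 := by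
    have h1 : Real.sqrt Λ' ≤ (rt + rPlus M a) * |ω| := by rwa [div_le_iff₀ hω0] at hrt1
    have h2 : Real.sqrt Λ' ^ 2 ≤ ((rt + rPlus M a) * |ω|) ^ 2 :=
      pow_le_pow_left₀ (Real.sqrt_nonneg _) h1 2
    rw [Real.sq_sqrt hΛ'pos.le, mul_pow, sq_abs] at h2
    linarith only [h2]
  have hsq2 : ω ^ 2 * (rt + rPlus M a) ^ 2 ≤ 2 * Λ' := by
    have h1 : (rt + rPlus M a) * |ω| ≤ Real.sqrt (2 * Λ') := by rwa [le_div_iff₀ hω0] at hrt2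
    have h2 : ((rt + rPlus M a) * |ω|) ^ 2 ≤ Real.sqrt (2 * Λ') ^ 2 :=
      pow_le_pow_left₀ (mul_nonneg hrtp0.le hω0.le) h1 2
    rw [Real.sq_sqrt (by linarith only [hΛ'pos]), mul_pow, sq_abs] at h2
    linarith only [h2]
  have hrbsq : Λ' - Es ≤ ω ^ 2 * (rb + rPlus M a) ^ 2 := by
    have hJ := thresholdProfile_ge (ω := ω) (Λ := Λ) (m := m) ha (hρ.rPlus_lt b₂)
    rw [← hrbdef] at hJ; linarith only [hJ, hJbE]
  have hrbsq2 : ω ^ 2 * (rb + rPlus M a) ^ 2 / 2 ≤ Λ' + 3 + Es := by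
    have hJ := thresholdProfile_le (ω := ω) (Λ := Λ) (m := m) ha hrbd
    linarith only [hJ, hJb3]
  have hrbp0 : 0 < rb + rPlus M a := by linarith only [hrb0, hrp]
  -- `r_t + r₊ ≤ 2(r_b + r₊)` and `r_b + r₊ ≤ 2(r_t + r₊)`
  have hrt_rb : rt + rPlus M a ≤ 2 * (rb + rPlus M a) := by
    have e : ω ^ 2 * (2 * (rb + rPlus M a)) ^ 2 = 4 * (ω ^ 2 * (rb + rPlus M a) ^ 2) := by ring
    have h1 : ω ^ 2 * (rt + rPlus M a) ^ 2 ≤ ω ^ 2 * (2 * (rb + rPlus M a)) ^ 2 := by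
      linarith only [hsq2, hrbsq, hE2, e]
    have h2 : (rt + rPlus M a) ^ 2 ≤ (2 * (rb + rPlus M a)) ^ 2 := le_of_mul_le_mul_left h1 hω2
    exact (pow_le_pow_iff_left₀ hrtp0.le (by positivity) two_ne_zero).1 h2
  have hrb_rt : rb + rPlus M a ≤ 2 * (rt + rPlus M a) := by
    have e : ω ^ 2 * (2 * (rt + rPlus M a)) ^ 2 = 4 * (ω ^ 2 * (rt + rPlus M a) ^ 2) := by ring
    have h1 : ω ^ 2 * (rb + rPlus M a) ^ 2 ≤ ω ^ 2 * (2 * (rt + rPlus M a)) ^ 2 := by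
      linarith only [hrbsq2, hE3, hsq, e]
    have h2 : (rb + rPlus M a) ^ 2 ≤ (2 * (rt + rPlus M a)) ^ 2 := le_of_mul_le_mul_left h1 hω2
    exact (pow_le_pow_iff_left₀ hrbp0.le (by positivity) two_ne_zero).1 h2
  -- `ω²(r_b + r₊) ≥ Λ′/(4r_b)` and `ω²(r_t + r₊) ≥ Λ′/(8r_b)`
  have hrb2 : rb + rPlus M a ≤ 2 * rb := by linarith only [hδ, hδdef]
  have hY : Λ' ≤ ω ^ 2 * (rb + rPlus M a) * (4 * rb) := by
    have h1 : Λ' ≤ 2 * (ω ^ 2 * (rb + rPlus M a) ^ 2) := by linarith only [hrbsq, hE2]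
    have h2 : ω ^ 2 * (rb + rPlus M a) ^ 2 ≤ ω ^ 2 * (rb + rPlus M a) * (2 * rb) := by
      have := mul_le_mul_of_nonneg_left hrb2 (show 0 ≤ ω ^ 2 * (rb + rPlus M a) by positivity)
      calc ω ^ 2 * (rb + rPlus M a) ^ 2 = ω ^ 2 * (rb + rPlus M a) * (rb + rPlus M a) := by ring
        _ ≤ ω ^ 2 * (rb + rPlus M a) * (2 * rb) := this
    calc Λ' ≤ 2 * (ω ^ 2 * (rb + rPlus M a) ^ 2) := h1
      _ ≤ 2 * (ω ^ 2 * (rb + rPlus M a) * (2 * rb)) := by linarith only [h2]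
      _ = ω ^ 2 * (rb + rPlus M a) * (4 * rb) := by ring
  have hX : Λ' ≤ ω ^ 2 * (rt + rPlus M a) * (8 * rb) := by
    have h1 : ω ^ 2 * (rb + rPlus M a) * (4 * rb) ≤ ω ^ 2 * (2 * (rt + rPlus M a)) * (4 * rb) :=
      mul_le_mul_of_nonneg_right (mul_le_mul_of_nonneg_left hrb_rt hω2.le) (by positivity)
    calc Λ' ≤ ω ^ 2 * (rb + rPlus M a) * (4 * rb) := hY
      _ ≤ ω ^ 2 * (2 * (rt + rPlus M a)) * (4 * rb) := h1
      _ = ω ^ 2 * (rt + rPlus M a) * (8 * rb) := by ring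
  -- `θ₁ r_b ≤ 3δ`
  have hδθ : θ₁ * rb ≤ 3 * δ := by
    have e : θ₁ * rb = θ₁ * rPlus M a + θ₁ * δ := by rw [hδdef]; ring
    have h1 : θ₁ * δ ≤ δ := mul_le_of_le_one_left hδ.le hθ₁1
    linarith only [e, h1, hδlo]
  -- the two gaps
  have hgap1 : rb - rt ≤ δ / 4 := by
    have hX0 : 0 < ω ^ 2 * (rt + rPlus M a) := by positivity
    -- `32 r_b (3 + E) ≤ Λ′δ ≤ 8 r_b X δ`
    have h5 : 96 * (3 + Es) ≤ θ₁ * Λ' := by linarith only [hEΛ, hθΛ]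
    have h6 : 32 * rb * (3 + Es) ≤ Λ' * δ := by
      have h7 : 32 * rb * (3 + Es) * θ₁ ≤ Λ' * δ * θ₁ := by
        calc 32 * rb * (3 + Es) * θ₁ = (θ₁ * rb) * (32 * (3 + Es)) := by ring
          _ ≤ (3 * δ) * (32 * (3 + Es)) := mul_le_mul_of_nonneg_right hδθ (by positivity)
          _ = δ * (96 * (3 + Es)) := by ring
          _ ≤ δ * (θ₁ * Λ') := mul_le_mul_of_nonneg_left h5 hδ.le
          _ = Λ' * δ * θ₁ := by ring
      exact le_of_mul_le_mul_right h7 hθ₁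
    have h8 : Λ' * δ ≤ ω ^ 2 * (rt + rPlus M a) * (8 * rb) * δ := mul_le_mul_of_nonneg_right hX hδ.le
    -- `X (r_b − r_t) ≤ 3 + E`, so `32 r_b X (r_b − r_t) ≤ 32 r_b (3 + E) ≤ 8 r_b X δ`
    have h9 : 32 * rb * (ω ^ 2 * (rt + rPlus M a) * (rb - rt)) ≤ 32 * rb * (3 + Es) :=
      mul_le_mul_of_nonneg_left h3 (by positivity)
    have h10 : ω ^ 2 * (rt + rPlus M a) * (32 * rb) * (rb - rt) ≤
        ω ^ 2 * (rt + rPlus M a) * (32 * rb) * (δ / 4) := by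
      calc ω ^ 2 * (rt + rPlus M a) * (32 * rb) * (rb - rt)
          = 32 * rb * (ω ^ 2 * (rt + rPlus M a) * (rb - rt)) := by ring
        _ ≤ 32 * rb * (3 + Es) := h9
        _ ≤ Λ' * δ := h6
        _ ≤ ω ^ 2 * (rt + rPlus M a) * (8 * rb) * δ := h8
        _ = ω ^ 2 * (rt + rPlus M a) * (32 * rb) * (δ / 4) := by ring
    exact le_of_mul_le_mul_left h10 (by positivity)
  have hgap2 : rt - rb ≤ δ / 4 := by
    have hY0 : 0 < ω ^ 2 * (rb + rPlus M a) := by positivity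
    have h5 : 48 * Es ≤ θ₁ * Λ' := by linarith only [hEΛ, hEs0]
    have h6 : 16 * rb * Es ≤ Λ' * δ := by
      have h7 : 16 * rb * Es * θ₁ ≤ Λ' * δ * θ₁ := by
        calc 16 * rb * Es * θ₁ = (θ₁ * rb) * (16 * Es) := by ring
          _ ≤ (3 * δ) * (16 * Es) := mul_le_mul_of_nonneg_right hδθ (by positivity)
          _ = δ * (48 * Es) := by ring
          _ ≤ δ * (θ₁ * Λ') := mul_le_mul_of_nonneg_left h5 hδ.le
          _ = Λ' * δ * θ₁ := by ring
      exact le_of_mul_le_mul_right h7 hθ₁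
    have h8 : Λ' * δ ≤ ω ^ 2 * (rb + rPlus M a) * (4 * rb) * δ := mul_le_mul_of_nonneg_right hY hδ.le
    have h9 : 16 * rb * (ω ^ 2 * (rb + rPlus M a) * (rt - rb)) ≤ 16 * rb * Es :=
      mul_le_mul_of_nonneg_left h4 (by positivity)
    have h10 : ω ^ 2 * (rb + rPlus M a) * (16 * rb) * (rt - rb) ≤
        ω ^ 2 * (rb + rPlus M a) * (16 * rb) * (δ / 4) := by
      calc ω ^ 2 * (rb + rPlus M a) * (16 * rb) * (rt - rb)
          = 16 * rb * (ω ^ 2 * (rb + rPlus M a) * (rt - rb)) := by ring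
        _ ≤ 16 * rb * Es := h9
        _ ≤ Λ' * δ := h6
        _ ≤ ω ^ 2 * (rb + rPlus M a) * (4 * rb) * δ := h8
        _ = ω ^ 2 * (rb + rPlus M a) * (16 * rb) * (δ / 4) := by ring
    exact le_of_mul_le_mul_left h10 (by positivity)
  -- `Λ′ ≤ 4ω²r_b²` (`r_t + r₊ ≤ r_b + δ/4 + r₊ ≤ 2 r_b`)
  have hΛ4 : Λ' ≤ 4 * ω ^ 2 * rb ^ 2 := by
    have h1 : rt + rPlus M a ≤ 2 * rb := by linarith only [hgap2, hδdef, hδ]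
    have h2 : (rt + rPlus M a) ^ 2 ≤ (2 * rb) ^ 2 := pow_le_pow_left₀ hrtp0.le h1 2
    have h5 := mul_le_mul_of_nonneg_left h2 hω2.le
    have e : ω ^ 2 * (2 * rb) ^ 2 = 4 * ω ^ 2 * rb ^ 2 := by ring
    linarith only [hsq, h5, e]
  obtain ⟨hbig1, hbig2⟩ := layerBarrier_largeness_of_margin (ω := ω) hrb0 hθ₁ hθ₁1 hf1 hΛ4 hδθ hΛ'
  have hΛ8 : ω ^ 2 * rb ^ 2 ≤ 8 * Λ' := by
    have h1 : rb ^ 2 ≤ (rb + rPlus M a) ^ 2 := pow_le_pow_left₀ hrb0.le (by linarith only [hrp]) 2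
    have h2 : (rb + rPlus M a) ^ 2 ≤ (2 * (rt + rPlus M a)) ^ 2 := pow_le_pow_left₀ hrbp0.le hrb_rt 2
    have h5 := mul_le_mul_of_nonneg_left (h1.trans h2) hω2.le
    have e : ω ^ 2 * (2 * (rt + rPlus M a)) ^ 2 = 4 * (ω ^ 2 * (rt + rPlus M a) ^ 2) := by ring
    linarith only [h5, e, hsq2]
  exact ⟨b₁, b₂, rt, hF, hφb₂, hb₂R, hb1u, hrb_lo, hrt, hrtd, hJrt, hgap1, hgap2, hΛ4, hΛ8, hbig1, hbig2,
    hEs0, hf1, hprof⟩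

end LayerRadii

end Kerr

end Literature.Geometry.Lorentzian

end
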